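import Literature.NumberTheory.EllipticCurves.PastenHeightBoundsLemma68LocalProofs
import Literature.NumberTheory.EllipticCurves.ManinConstantArbitraryParametrizationIntegralProofs
import Literature.NumberTheory.EllipticCurves.KenkuMinimalLevels
import Literature.NumberTheory.EllipticCurves.OpenImageMazurInputs
import HarnessLib

/-!
# Stub-ideation k1 sketch for `stub_pastenLemma68 : PastenShimura2024_lemma_6_8`
(crux `DefiniteRTControlPrime`, route DefiniteXi). Elaboration check only of the helper-lemma
STATEMENTS proposed in `STUB-IDEAS-stub_pastenLemma68-1.md`; `sorry` marks the ones a prover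
would have to supply. Nothing here is proposed to the tree.
-/

noncomputable section

open scoped Classical

open WeierstrassCurve IsDedekindDomain
open Literature.NumberTheory.EllipticCurves Literature.NumberTheory.EllipticCurves.ModularForms

namespace Summit.ABC.ABC.Cruxes.DefiniteRTControlPrime.Sketch.StubIdeas1

/-! ## Plan A — import through the tree's Mazur–Kenku glue (all helpers EXIST) -/

/-- A1: the stub from the single leaf `mazurKenku_exists_cyclic_isogeny` (tree one-liner). -/
theorem stub_pastenLemma68_of_mazurKenku (hMK : mazurKenku_exists_cyclic_isogeny) :
    PastenShimura2024_lemma_6_8 :=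
  PastenShimura2024_lemma_6_8_of_mazurKenku' hMK

/-- A2: the sibling stub `stub_pasten163` from the SAME leaf (integrality input already
discharged in the tree by `int_of_smul_periodLattice_le_all`). -/
theorem stub_pasten163_of_mazurKenku (hMK : mazurKenku_exists_cyclic_isogeny) :
    PastenShimura2024_minimalDegree_le_163_mul :=
  PastenShimura2024_minimalDegree_le_163_mul_of_mazurKenku' hMK

/-- A3: finer trust base {Mazur Thm 1, Kenku's 84 minimal levels}. -/
theorem stub_pastenLemma68_of_mazur_of_kenku (hM : mazur_isogeny_irreducible)
    (hK : kenku_minimalLevels_mem_kenkuDegrees) : PastenShimura2024_lemma_6_8 :=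
  PastenShimura2024_lemma_6_8_of_mazurKenku' (mazurKenku_exists_cyclic_isogeny_of_mazur_of_kenku hM hK)

/-- A4: finest trust base in the tree {Cor. 4.4, Prop. 5.1-classes, Kenku levels}. -/
theorem stub_pastenLemma68_of_inputs (h44 : Mazur1978.cor44_valuation_j_le_one)
    (h51 : Mazur1978.prop51_exponent_classes_of_additive)
    (hK : kenku_minimalLevels_mem_kenkuDegrees) : PastenShimura2024_lemma_6_8 :=
  stub_pastenLemma68_of_mazur_of_kenku (mazur_isogeny_irreducible_holds_of h44 h51) hK

/-! ## Plan B — sharpen the leaf to the case the stub quantifies over (a multiplicative place) -/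

/-- B-leaf: cyclic `ℚ`-isogenies out of a curve with a multiplicative place have degree `≤ 163`
(Mazur–Kenku restricted to non-integral `j`). -/
def CyclicDegreeLe163OfMult : Prop :=
  ∀ (W W' : WeierstrassCurve ℚ) [W.IsElliptic] [W'.IsElliptic] (φ : Isogeny W W'), φ.IsCyclic →
    ∀ v : HeightOneSpectrum ℤ, W.HasMultiplicativeReductionAt v → φ.degree ≤ 163

/-- B1 (1 cycle; copy of the proof of `PastenShimura2024_lemma_6_8_of_mazurKenku'` with
`IsIsogenous.exists_isCyclic` + `exists_ordMinimalDiscriminant_mul_eq_mul_of_isCyclic`). -/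
theorem lemma_6_8_of_cyclicDegreeLe163OfMult (h : CyclicDegreeLe163OfMult) :
    PastenShimura2024_lemma_6_8 := by
  intro W W' _ _ hiso v hv
  have hv' : W'.HasMultiplicativeReductionAt v := hasMultiplicativeReductionAt_of_isIsogenous hiso v hv
  obtain ⟨φ, hcyc⟩ := hiso.exists_isCyclic
  have hn : φ.degree ≤ 163 := h W W' φ hcyc v hv
  obtain ⟨a, b, ha, hb, hab, h⟩ :=
    exists_ordMinimalDiscriminant_mul_eq_mul_of_isCyclic φ.degree φ hcyc rfl v hv hv'
  have habn : a * b ≤ φ.degree := Nat.le_of_dvd φ.degree_pos hab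
  refine ⟨a, b, ha, ?_, hb, ?_, h⟩
  · have : a ≤ a * b := Nat.le_mul_of_pos_right a hb
    omega
  · have : b ≤ a * b := Nat.le_mul_of_pos_left b ha
    omega

/-- B2: the B-leaf from Mazur–Kenku (sanity: the sharpened leaf is implied by the tree leaf). -/
theorem cyclicDegreeLe163OfMult_of_mazurKenku (hMK : mazurKenku_exists_cyclic_isogeny) :
    CyclicDegreeLe163OfMult := fun W W' _ _ φ hφ _ _ ↦
  le_of_mem_kenkuDegrees (isCyclic_degree_mem_kenkuDegrees_of_mazurKenku hMK φ hφ)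

/-! ## Plan C — odd-place economy (what the crux actually consumes: `q ≠ 2`) -/

/-- C-leaf: Lemma 6.8 at ODD multiplicative places only. -/
def Lemma68Odd : Prop :=
  ∀ (W W' : WeierstrassCurve ℚ) [W.IsElliptic] [W'.IsElliptic], W.IsIsogenous W' →
    ∀ v : HeightOneSpectrum ℤ, (2 : ℤ) ∉ v.asIdeal → W.HasMultiplicativeReductionAt v →
      ∃ m n : ℕ, 0 < m ∧ m ≤ 163 ∧ 0 < n ∧ n ≤ 163 ∧
        W.ordMinimalDiscriminant v * n = W'.ordMinimalDiscriminant v * m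

/-- The five primes `ℓ` NOT covered by Mazur's Cor. 4.4 (`ℓ = 11 ∨ 17 ≤ ℓ` fails). -/
def smallIsogenyPrimes : Finset ℕ := {2, 3, 5, 7, 13}

/-- The 21 of Kenku's 84 minimal composite levels supported on `{2,3,5,7,13}` (computed). -/
def smallMinimalLevels : Finset ℕ :=
  {20, 24, 26, 28, 30, 32, 35, 36, 39, 42, 45, 49, 50, 54, 63, 65, 75, 81, 91, 125, 169}

/-- C-fact: Kenku's level exclusions restricted to the 21 small-support levels
(a strict weakening of `kenku_minimalLevels_mem_kenkuDegrees`). -/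
def KenkuSmallLevels : Prop :=
  ∀ (W W' : WeierstrassCurve ℚ) [W.IsElliptic] [W'.IsElliptic] (φ : Isogeny W W'),
    φ.IsCyclic → φ.degree ∉ smallMinimalLevels

/-- C1 (1 cycle): at an ODD multiplicative place, Cor. 4.4 alone confines the prime support of a
cyclic degree to `{2,3,5,7,13}` (stable subgroup `E[ℓ] ∩ ker φ` as in
`mem_mazurPrimes_of_prime_dvd_degree`; `valuation_j_eq_exp_ordMinimalDiscriminant` gives
`v(j) > 1`; bridge `HeightOneSpectrum ℤ ↔ HeightOneSpectrum (𝓞 ℚ)` is the typing risk). -/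
theorem prime_dvd_degree_mem_smallIsogenyPrimes_of_cor44 (h44 : Mazur1978.cor44_valuation_j_le_one)
    {W W' : WeierstrassCurve ℚ} [W.IsElliptic] [W'.IsElliptic] (φ : Isogeny W W')
    (hφ : φ.IsCyclic) (v : HeightOneSpectrum ℤ) (hv2 : (2 : ℤ) ∉ v.asIdeal)
    (hv : W.HasMultiplicativeReductionAt v) {ℓ : ℕ} (hℓ : ℓ.Prime) (hℓd : ℓ ∣ φ.degree) :
    ℓ ∈ smallIsogenyPrimes := by
  sorry

/-- C2 (1 cycle, finite bookkeeping over `exists_minimal_dvd_of_not_mem_kenkuDegrees` /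
`exists_isCyclic_degree_eq_of_dvd`): small prime support + the 21 levels ⇒ degree `≤ 163`
(indeed `∈ kenkuDegrees`). -/
theorem cyclicDegree_le_163_of_cor44_of_kenkuSmall (h44 : Mazur1978.cor44_valuation_j_le_one)
    (hK : KenkuSmallLevels) {W W' : WeierstrassCurve ℚ} [W.IsElliptic] [W'.IsElliptic]
    (φ : Isogeny W W') (hφ : φ.IsCyclic) (v : HeightOneSpectrum ℤ) (hv2 : (2 : ℤ) ∉ v.asIdeal)
    (hv : W.HasMultiplicativeReductionAt v) : φ.degree ≤ 163 := by
  sorry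

/-- C3 (1 cycle, same proof as B1 with the extra binder threaded): the odd-place leaf. -/
theorem lemma68Odd_of_cor44_of_kenkuSmall (h44 : Mazur1978.cor44_valuation_j_le_one)
    (hK : KenkuSmallLevels) : Lemma68Odd := by
  intro W W' _ _ hiso v hv2 hv
  have hv' : W'.HasMultiplicativeReductionAt v := hasMultiplicativeReductionAt_of_isIsogenous hiso v hv
  obtain ⟨φ, hcyc⟩ := hiso.exists_isCyclic
  have hn : φ.degree ≤ 163 := cyclicDegree_le_163_of_cor44_of_kenkuSmall h44 hK φ hcyc v hv2 hv
  obtain ⟨a, b, ha, hb, hab, h⟩ :=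
    exists_ordMinimalDiscriminant_mul_eq_mul_of_isCyclic φ.degree φ hcyc rfl v hv hv'
  have habn : a * b ≤ φ.degree := Nat.le_of_dvd φ.degree_pos hab
  refine ⟨a, b, ha, ?_, hb, ?_, h⟩
  · have : a ≤ a * b := Nat.le_mul_of_pos_right a hb
    omega
  · have : b ≤ a * b := Nat.le_mul_of_pos_left b ha
    omega

/-- Sanity: the odd-place leaf is a weakening of the stub's fact. -/
theorem lemma68Odd_of_lemma_6_8 (h : PastenShimura2024_lemma_6_8) : Lemma68Odd :=
  fun W W' _ _ hiso v _ hv ↦ h W W' hiso v hv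

/-- Sanity: the small-level fact is a weakening of Kenku's fact in the tree. -/
theorem kenkuSmallLevels_of_mazurKenku (hMK : mazurKenku_exists_cyclic_isogeny) : KenkuSmallLevels := by
  intro W W' _ _ φ hφ hmem
  have hK := isCyclic_degree_mem_kenkuDegrees_of_mazurKenku hMK φ hφ
  revert hK hmem
  generalize φ.degree = d
  simp only [smallMinimalLevels, kenkuDegrees, Finset.mem_insert, Finset.mem_singleton,
    Finset.mem_union, Finset.mem_Icc]
  omega

end Summit.ABC.ABC.Cruxes.DefiniteRTControlPrime.Sketch.StubIdeas1

end
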